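import Summits.QuantumFields.YangMills.Theorems.AtomicCalibrationRMirrorCalibrationDefs
import Summits.QuantumFields.YangMills.Theorems.InfiniteVolumeContinuumIVEuclideanInvarianceSigned
import Summits.QuantumFields.YangMills.Theorems.BalabanLadderInfVolTranslations
import Summits.QuantumFields.YangMills.Theorems.LangevinControlUVOSLegsFromFemtoAndGapStubAssemblyUniformBoundPrep
import HarnessLib

/-!
# E1 `stub_atomCeiling` of LINES «AtomicEngine» / «MirrorCalibration» on crux ⟨stmt-QuantumFields-28169⟩ — part 1/2:
# reflection bookkeeping, `ℤ⁴`-translation transport, the core estimate ABOVE the mirror, and the time-reflection swap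

Author of the mathematics and of the Lean proof: planner **ym-idea-11 g15** (HOME `ideators/ym-idea-11/g15/bc/e1_atomCeilings.lean`,
sha 06962753, verified by idea-crit-9 ACK #86d); landed unchanged (split at the 400-line cap, §0/§1 currency defs replaced by the
import of `Theorems/AtomicCalibrationRMirrorCalibrationDefs.lean` = critic price #86 P2) by the LEAD seat ym-line-sfw-p2 g74 as a
landing service.

Content of part 1 (§R, §T, §A, first half of §B of the source): the route's axis-0 reflected site vs the tree's
`InfVolRP.reflSite`; the currency identity «E1's reflected double sum = `rpSquare`» at `k = 0, c = 0`; transport of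
atoms and two-point weights under `ℤ⁴`-translations of odd-torus limit states; `core_above` (mirror `x₀ = c`, carrier at
`x₀ ≥ c + t/s + 1`: translate to a sub-cell atom walked UP and apply the PROVED `OnsetContraction` + `s ∉ onset`);
`M2_reflect_swap` / `atomWt_hat` (time reflection of states and profiles).  Part 2
(`AtomicCalibrationRAtomCeilings.lean`) finishes §B/§0′/§C and proves `stub_atomCeiling : OnsetContraction → AtomCeilings`.

HONEST LABEL: lattice-symmetry plumbing around the onset DEFINITION; nothing here is a β-uniform bound, nothing bears
on NT / UV / IR, no crux, rung, leaf or summit is proved, and the Yang–Mills mass gap is NOT proved.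
-/

set_option autoImplicit false

noncomputable section

open scoped BigOperators
open MeasureTheory Filter Topology
open Literature.MathematicalPhysics.QuantumFieldTheory Literature.MathematicalPhysics.QuantumLattice
open Literature.Probability.LatticeModels (Site)
open Summit.QuantumFields.YangMills.Theorems.InfiniteVolume (stateMomentStr stateMomentStr_configPermZd
  stateMomentStr_reflSite stateMomentStr_translate_of_mem_oddTorusLimitPoints plane_configPermZd
  single_add_single_permPlane)
open Summit.QuantumFields.YangMills.Theorems.InfVolRP (centreOffset centreOffset_time two_mul_centreOffset_zero
  reflSite_apply_zero reflSite_apply_of_ne smul_reflSite_add_of_centre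
  mem_infiniteVolumeLimitPoints_of_mem_oddTorusLimitPoints)
open Summit.QuantumFields.YangMills.Theorems.OSLegsFromFemtoAndGap (permPlane permPlane_valid)
open Summit.QuantumFields.GaugeBoot (map_configPermZd_eq_of_mem_infiniteVolumeLimitPoints
  map_configSiteReflect_zero_eq_of_mem_infiniteVolumeLimitPoints)
open Summit.QuantumFields.YangMills.Theses.OnsetTautology

namespace Summit.QuantumFields.YangMills.Cruxes.AtomicCalibrationR.MirrorCalibration


/-- For a valid orientation, the route's axis-`0` / plane-`0` reflected base site is the tree's `InfVolRP.reflSite`. -/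
theorem reflSite_zero_zero_eq {p : (Fin 4 × Fin 4) × (Fin 4 → ℤ)} (hq : p.1.1 < p.1.2) :
    reflSite 0 0 p = Summit.QuantumFields.YangMills.Theorems.InfVolRP.reflSite p.1 p.2 := by
  have h2 : p.1.2 ≠ 0 := fun h => by rw [h] at hq; exact (Fin.not_lt_zero _) hq
  funext l
  by_cases hl : l = 0
  · subst hl
    rw [reflSite_apply_zero]
    simp only [reflSite, if_true, h2, or_false, mul_zero, zero_sub]
  · rw [reflSite_apply_of_ne _ _ hl]
    simp only [reflSite, hl, if_false]

/-- The pair mirror `p ↦ (p.1, reflSite 0 c p)` is an involution. -/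
theorem reflSite_zero_invol (c : ℤ) (p : (Fin 4 × Fin 4) × (Fin 4 → ℤ)) :
    reflSite 0 c (p.1, reflSite 0 c p) = p.2 := by
  funext l
  by_cases hl : l = 0
  · subst hl
    simp only [reflSite, if_true]
    ring
  · simp only [reflSite, hl, if_false]

/-- `atomWr (q, reflSite 0 0 (q, x)) = atomWt (q, x)`. -/
theorem atomWr_reflPair (b : SchwartzMap (EuclideanSpace ℝ (Fin 4)) ℝ) (Q : Finset (Fin 4 × Fin 4)) (s : ℝ)
    (y : EuclideanSpace ℝ (Fin 4)) (p : (Fin 4 × Fin 4) × (Fin 4 → ℤ)) :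
    atomWr b Q s y (p.1, reflSite 0 0 p) = atomWt b Q s y p := by
  unfold atomWr atomWt
  dsimp only
  by_cases hq : p.1 ∈ Q ∧ p.1.1 < p.1.2
  · rw [if_pos hq, if_pos hq, reflSite_zero_zero_eq hq.2,
      smul_reflSite_add_of_centre s p.1 p.2 (centreOffset p.1) (two_mul_centreOffset_zero hq.2),
      timeReflection_timeReflection]
  · rw [if_neg hq, if_neg hq]

variable {G : Type} [Group G] [TopologicalSpace G] [IsTopologicalGroup G] [CompactSpace G]
  [MeasurableSpace G] [BorelSpace G]

omit [IsTopologicalGroup G] [CompactSpace G] [BorelSpace G] in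
/-- **Currency identity (squares)** at `k = 0`, `c = 0`: E1's reflected double sum IS `rpSquare`. -/
theorem reflectedDoubleSum_eq_rpSquare (r : LatticeRep G) (μ : Measure (LGConfig 4 G))
    (b : SchwartzMap (EuclideanSpace ℝ (Fin 4)) ℝ) (S : Finset ((Fin 4 × Fin 4) × (Fin 4 → ℤ)))
    (q : Fin 4 × Fin 4) (s : ℝ) (y : EuclideanSpace ℝ (Fin 4)) (hS : ∀ p, atomWt b {q} s y p ≠ 0 → p ∈ S) :
    ∑ p ∈ S, ∑ p' ∈ S, atomWt b {q} s y p * atomWt b {q} s y p' *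
        stateMomentStr G r μ 2 ![p.1, p'.1] ![reflSite 0 0 p, p'.2] = rpSquare r μ b {q} s y := by
  unfold rpSquare
  have hinj : Set.InjOn (fun p : (Fin 4 × Fin 4) × (Fin 4 → ℤ) => ((p.1, reflSite 0 0 p) :
      (Fin 4 × Fin 4) × (Fin 4 → ℤ))) ↑S := by
    intro p _ p' _ h
    dsimp only at h
    have h1 : p.1 = p'.1 := (Prod.mk.inj h).1
    have h2 := congrArg (reflSite 0 0) h
    rw [reflSite_zero_invol, reflSite_zero_invol] at h2
    exact Prod.ext h1 h2
  rw [tsum_eq_sum (s := (S.image fun p => (p.1, reflSite 0 0 p)) ×ˢ S) (fun pp hpp => by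
    rw [Finset.mem_product, not_and_or] at hpp
    rcases hpp with h1 | h2
    · have h0 : atomWr b {q} s y pp.1 = 0 := by
        by_contra hne
        apply h1
        rw [Finset.mem_image]
        refine ⟨(pp.1.1, reflSite 0 0 pp.1), hS _ ?_, ?_⟩
        · rwa [atomWt_reflPair']
        · exact Prod.ext rfl (reflSite_zero_invol 0 pp.1)
      rw [h0, zero_mul, zero_mul]
    · have h0 : atomWt b {q} s y pp.2 = 0 := by
        by_contra hne
        exact h2 (hS _ hne)
      rw [h0, mul_zero, zero_mul]),
    Finset.sum_product, Finset.sum_image hinj]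
  refine Finset.sum_congr rfl fun p _ => Finset.sum_congr rfl fun p' _ => ?_
  dsimp only
  rw [atomWr_reflPair]
where
  /-- `atomWt (q, reflSite 0 0 (q, x)) = atomWr (q, x)`. -/
  atomWt_reflPair' (b : SchwartzMap (EuclideanSpace ℝ (Fin 4)) ℝ) (Q : Finset (Fin 4 × Fin 4)) (s : ℝ)
      (y : EuclideanSpace ℝ (Fin 4)) (p : (Fin 4 × Fin 4) × (Fin 4 → ℤ)) :
      atomWt b Q s y (p.1, reflSite 0 0 p) = atomWr b Q s y p := by
    have h := atomWr_reflPair b Q s y (p.1, reflSite 0 0 p)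
    dsimp only at h
    rw [reflSite_zero_invol] at h
    exact h.symm

/-! ## §T Translations: mirror `x₀ = c` and spatial offset moved to `x₀ = 0` -/

/-- Shifting the sites by `-v` and the offset by `-s•v` leaves the atom weights unchanged. -/
theorem atomWt_shift (b : SchwartzMap (EuclideanSpace ℝ (Fin 4)) ℝ) (Q : Finset (Fin 4 × Fin 4)) (s : ℝ)
    (y : EuclideanSpace ℝ (Fin 4)) (v : Site 4) (p : (Fin 4 × Fin 4) × (Fin 4 → ℤ)) :
    atomWt b Q s (y - s • siteToE v) (p.1, p.2 - v) = atomWt b Q s y p := by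
  unfold atomWt
  dsimp only
  by_cases h : p.1 ∈ Q ∧ p.1.1 < p.1.2
  · rw [if_pos h, if_pos h, Summit.QuantumFields.YangMills.Theorems.OSLegsFromFemtoAndGap.siteToE_sub]
    congr 1
    simp only [smul_add, smul_sub]
    abel
  · rw [if_neg h, if_neg h]

omit [Group G] [TopologicalSpace G] [IsTopologicalGroup G] [CompactSpace G] [MeasurableSpace G] [BorelSpace G] in
/-- The mirror `x₀ = c` seen from the shifted sites is the mirror `x₀ = 0`. -/
theorem reflSite_zero_shift (c : ℤ) (p : (Fin 4 × Fin 4) × (Fin 4 → ℤ)) (v : Site 4) (hv : v 0 = c) :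
    reflSite 0 0 (p.1, p.2 - v) + v = reflSite 0 c p := by
  funext l
  by_cases hl : l = 0
  · subst hl
    simp only [reflSite, if_true, Pi.add_apply, Pi.sub_apply, hv]
    ring
  · simp only [reflSite, hl, if_false, Pi.add_apply, Pi.sub_apply, sub_add_cancel]

/-- Two-point centred weights of an odd-torus limit state are translation invariant. -/
theorem M2_translate (r : LatticeRep G) {β : ℝ} {μ : Measure (LGConfig 4 G)} (hμ : μ ∈ oddTorusLimitPoints r β)
    (a a' : Fin 4 × Fin 4) (x x' v : Site 4) :
    stateMomentStr G r μ 2 ![a, a'] ![x + v, x' + v] = stateMomentStr G r μ 2 ![a, a'] ![x, x'] := by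
  rw [← stateMomentStr_translate_of_mem_oddTorusLimitPoints r hμ 2 ![a, a'] ![x, x'] v]
  congr 1
  funext i
  fin_cases i <;> rfl

/-- **Translation step.**  E1's reflected double sum for the mirror `x₀ = c` equals `rpSquare` of the same atom with
offset `y - s•v`, for any lattice vector `v` with `v₀ = c`. -/
theorem reflectedDoubleSum_shift (r : LatticeRep G) {β : ℝ} {μ : Measure (LGConfig 4 G)}
    (hμ : μ ∈ oddTorusLimitPoints r β) (b : SchwartzMap (EuclideanSpace ℝ (Fin 4)) ℝ)
    (S : Finset ((Fin 4 × Fin 4) × (Fin 4 → ℤ))) (q : Fin 4 × Fin 4) (s : ℝ) (y : EuclideanSpace ℝ (Fin 4))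
    (c : ℤ) (v : Site 4) (hv : v 0 = c) (hS : ∀ p, atomWt b {q} s y p ≠ 0 → p ∈ S) :
    ∑ p ∈ S, ∑ p' ∈ S, atomWt b {q} s y p * atomWt b {q} s y p' *
        stateMomentStr G r μ 2 ![p.1, p'.1] ![reflSite 0 c p, p'.2] = rpSquare r μ b {q} s (y - s • siteToE v) := by
  have hinj : Set.InjOn (fun p : (Fin 4 × Fin 4) × (Fin 4 → ℤ) => ((p.1, p.2 - v) :
      (Fin 4 × Fin 4) × (Fin 4 → ℤ))) ↑S := by
    intro p _ p' _ h
    dsimp only at h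
    have h1 : p.1 = p'.1 := (Prod.mk.inj h).1
    have h2 : p.2 - v = p'.2 - v := (Prod.mk.inj h).2
    exact Prod.ext h1 (sub_left_injective h2)
  have hS₁ : ∀ p, atomWt b {q} s (y - s • siteToE v) p ≠ 0 → p ∈ S.image fun p => (p.1, p.2 - v) := by
    intro p hp
    rw [Finset.mem_image]
    refine ⟨(p.1, p.2 + v), hS _ ?_, Prod.ext rfl (add_sub_cancel_right p.2 v)⟩
    rw [← atomWt_shift b {q} s y v]
    dsimp only
    rwa [add_sub_cancel_right]
  rw [← reflectedDoubleSum_eq_rpSquare r μ b (S.image fun p => (p.1, p.2 - v)) q s (y - s • siteToE v) hS₁,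
    Finset.sum_image hinj]
  refine Finset.sum_congr rfl fun p _ => ?_
  rw [Finset.sum_image hinj]
  refine Finset.sum_congr rfl fun p' _ => ?_
  dsimp only
  rw [atomWt_shift, atomWt_shift, ← M2_translate r hμ p.1 p'.1 (reflSite 0 0 (p.1, p.2 - v)) (p'.2 - v) v,
    reflSite_zero_shift c p v hv, sub_add_cancel]

/-! ## §A The core: mirror `x₀ = c`, atom ABOVE at lattice distance `≥ t/s` — translation + contraction + onset -/

/-- OS contraction in the route's currency, for a fixed state and profile (supplied by `OnsetContraction`). -/
def Contracts (r : LatticeRep G) (μ : Measure (LGConfig 4 G)) (b : SchwartzMap (EuclideanSpace ℝ (Fin 4)) ℝ) :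
    Prop :=
  ∀ (Q : Finset (Fin 4 × Fin 4)) (s : ℝ) (y : EuclideanSpace ℝ (Fin 4)) (m : ℕ), 0 < s → 0 ≤ y 0 →
    rpSquare r μ b Q s (y + (s * (m : ℝ)) • EuclideanSpace.single 0 (1 : ℝ)) ≤ rpSquare r μ b Q s y

omit [Group G] [TopologicalSpace G] [IsTopologicalGroup G] [CompactSpace G] [MeasurableSpace G] [BorelSpace G] in
/-- Time coordinate of an atom argument. -/
theorem atomArg_apply (s : ℝ) (x : Site 4) (q : Fin 4 × Fin 4) (y : EuclideanSpace ℝ (Fin 4)) (i : Fin 4) :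
    (s • (siteToE x + centreOffset q) - y) i = s * ((x i : ℝ) + centreOffset q i) - y i := by
  simp only [PiLp.sub_apply, PiLp.smul_apply, PiLp.add_apply, siteToE_apply, smul_eq_mul]

omit [Group G] [TopologicalSpace G] [IsTopologicalGroup G] [CompactSpace G] [MeasurableSpace G] [BorelSpace G] in
/-- Non-vanishing of an atom weight (unfolding lemma, flat form). -/
theorem atomWt_ne_zero_iff_flat (b : SchwartzMap (EuclideanSpace ℝ (Fin 4)) ℝ) (Q : Finset (Fin 4 × Fin 4)) (s : ℝ)
    (y : EuclideanSpace ℝ (Fin 4)) (p : (Fin 4 × Fin 4) × (Fin 4 → ℤ)) :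
    atomWt b Q s y p ≠ 0 ↔ p.1 ∈ Q ∧ p.1.1 < p.1.2 ∧ b (s • (siteToE p.2 + centreOffset p.1) - y) ≠ 0 := by
  constructor
  · intro hne
    unfold atomWt at hne
    by_cases h : p.1 ∈ Q ∧ p.1.1 < p.1.2
    · rw [if_pos h] at hne
      exact ⟨h.1, h.2, hne⟩
    · rw [if_neg h] at hne
      exact absurd rfl hne
  · rintro ⟨h1, h2, h3⟩
    unfold atomWt
    rw [if_pos ⟨h1, h2⟩]
    exact h3

/-- **Core (above).**  Onset in `(0, A]`, scale `s > A`, mirror `x₀ = c`, every carrier site at `x₀ ≥ c + t/s`: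
the reflected double sum is `≤ ε`. -/
theorem core_above (r : LatticeRep G) {β : ℝ} {μ : Measure (LGConfig 4 G)} (hμ : μ ∈ oddTorusLimitPoints r β)
    (b : SchwartzMap (EuclideanSpace ℝ (Fin 4)) ℝ) (hcon : Contracts r μ b) (ε A : ℝ) (hε : 0 < ε)
    (hA : ∀ s ∈ onsetSet r μ b ε, s ≤ A) (S : Finset ((Fin 4 × Fin 4) × (Fin 4 → ℤ))) (q : Fin 4 × Fin 4)
    (s t : ℝ) (y : EuclideanSpace ℝ (Fin 4)) (c : ℤ) (hs : 0 < s) (hAs : A < s)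
    (ht : ∀ u, b u ≠ 0 → ‖u‖ ≤ t) (hS : ∀ p, atomWt b {q} s y p ≠ 0 → p ∈ S)
    (hside : ∀ p ∈ S, (c : ℝ) + t / s ≤ ((p.2 0 : ℤ) : ℝ)) :
    ∑ p ∈ S, ∑ p' ∈ S, atomWt b {q} s y p * atomWt b {q} s y p' *
        stateMomentStr G r μ 2 ![p.1, p'.1] ![reflSite 0 c p, p'.2] ≤ ε := by
  by_cases h0 : ∀ p ∈ S, atomWt b {q} s y p = 0
  · rw [Finset.sum_eq_zero fun p hp => Finset.sum_eq_zero fun p' _ => by rw [h0 p hp, zero_mul, zero_mul]]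
    exact hε.le
  simp only [not_forall] at h0
  obtain ⟨p₀, hp₀, hw₀⟩ := h0
  obtain ⟨-, hval, hb₀⟩ := (atomWt_ne_zero_iff_flat b {q} s y p₀).1 hw₀
  -- the time offset relative to the mirror is ≥ 0
  have hu0 : |(s • (siteToE p₀.2 + centreOffset p₀.1) - y) 0| ≤ t :=
    le_trans (by simpa only [Real.norm_eq_abs] using PiLp.norm_apply_le (s • (siteToE p₀.2 + centreOffset p₀.1) - y) 0)
      (ht _ hb₀)
  rw [atomArg_apply] at hu0
  have ho := (centreOffset_time p₀.1).1
  have hsd := hside p₀ hp₀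
  have h1 : t ≤ s * (((p₀.2 0 : ℤ) : ℝ) - c) := by
    have := mul_le_mul_of_nonneg_left hsd hs.le
    rw [mul_add, mul_div_cancel₀ t hs.ne'] at this
    linarith
  have hyc : 0 ≤ y 0 - s * c := by
    have := (abs_le.1 hu0).2
    nlinarith
  -- the shift vector
  let v : Site 4 := fun i => if i = 0 then c else ⌊y i / s⌋
  have hv0 : v 0 = c := by simp [v]
  rw [reflectedDoubleSum_shift r hμ b S q s y c v hv0 hS]
  have hy₁ : ∀ i, (y - s • siteToE v) i = y i - s * (v i : ℝ) := fun i => by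
    simp only [PiLp.sub_apply, PiLp.smul_apply, siteToE_apply, smul_eq_mul]
  have hy₁0 : 0 ≤ (y - s • siteToE v) 0 := by rw [hy₁, hv0]; exact hyc
  have hy₁i : ∀ i, i ≠ 0 → 0 ≤ (y - s • siteToE v) i ∧ (y - s • siteToE v) i < s := by
    intro i hi
    rw [hy₁]
    have hvi : (v i : ℝ) = ((⌊y i / s⌋ : ℤ) : ℝ) := by simp [v, hi]
    rw [hvi]
    have h1 := Int.floor_le (y i / s)
    have h2 := Int.lt_floor_add_one (y i / s)
    rw [le_div_iff₀ hs] at h1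
    rw [div_lt_iff₀ hs] at h2
    constructor <;> nlinarith
  -- walk down to the sub-cell offset
  set y₁ : EuclideanSpace ℝ (Fin 4) := y - s • siteToE v with hy₁def
  let m : ℕ := ⌊y₁ 0 / s⌋₊
  have hm1 : (m : ℝ) ≤ y₁ 0 / s := Nat.floor_le (div_nonneg hy₁0 hs.le)
  have hm2 : y₁ 0 / s < m + 1 := Nat.lt_floor_add_one _
  rw [le_div_iff₀ hs] at hm1
  rw [div_lt_iff₀ hs] at hm2
  let y' : EuclideanSpace ℝ (Fin 4) := y₁ - (s * (m : ℝ)) • EuclideanSpace.single 0 (1 : ℝ)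
  have hy'ap : ∀ i, y' i = y₁ i - (if i = 0 then s * (m : ℝ) else 0) := fun i => by
    simp only [y', PiLp.sub_apply, PiLp.smul_apply, PiLp.single_apply, smul_eq_mul, mul_ite, mul_one,
      mul_zero]
  have hy' : ∀ i, 0 ≤ y' i ∧ y' i ≤ s := by
    intro i
    rw [hy'ap]
    by_cases hi : i = 0
    · subst hi
      rw [if_pos rfl]
      constructor <;> nlinarith
    · rw [if_neg hi, sub_zero]
      exact ⟨(hy₁i i hi).1, (hy₁i i hi).2.le⟩
  have hcon' : rpSquare r μ b {q} s (y' + (s * (m : ℝ)) • EuclideanSpace.single 0 (1 : ℝ)) ≤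
      rpSquare r μ b {q} s y' := hcon {q} s y' m hs (hy' 0).1
  have hyy : y' + (s * (m : ℝ)) • EuclideanSpace.single 0 (1 : ℝ) = y₁ := sub_add_cancel _ _
  rw [hyy] at hcon'
  have hlt : rpSquare r μ b {q} s y' < ε := by
    by_contra h
    exact absurd (hA s ⟨hs, q, y', hy', not_lt.mp h⟩) (not_le.mpr hAs)
  exact hcon'.trans hlt.le

/-! ## §B Atom BELOW the mirror: the time reflection of the state and of the profile -/

/-- The lattice time shift by `2c`. -/
def tshift (c : ℤ) : Site 4 := fun l => if l = 0 then 2 * c else 0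

omit [Group G] [TopologicalSpace G] [IsTopologicalGroup G] [CompactSpace G] [MeasurableSpace G] [BorelSpace G] in
/-- The mirror `x₀ = c` is the mirror `x₀ = 0` followed by the time shift `2c`. -/
theorem reflSite_zero_eq_add (c : ℤ) (p : (Fin 4 × Fin 4) × (Fin 4 → ℤ)) :
    reflSite 0 c p = reflSite 0 0 p + tshift c := by
  funext l
  by_cases hl : l = 0
  · subst hl
    simp only [reflSite, tshift, if_true, Pi.add_apply]
    ring
  · simp only [reflSite, tshift, hl, if_false, Pi.add_apply, add_zero]

omit [Group G] [TopologicalSpace G] [IsTopologicalGroup G] [CompactSpace G] [MeasurableSpace G] [BorelSpace G] in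
/-- Reflecting the `c`-mirrored plaquette in `x₀ = 0` is the time shift by `-2c`. -/
theorem reflSite_zero_zero_hat (c : ℤ) (p : (Fin 4 × Fin 4) × (Fin 4 → ℤ)) :
    reflSite 0 0 (p.1, reflSite 0 c p) = p.2 - tshift c := by
  funext l
  by_cases hl : l = 0
  · subst hl
    simp only [reflSite, tshift, if_true, Pi.sub_apply]
    ring
  · simp only [reflSite, tshift, hl, if_false, Pi.sub_apply, sub_zero]

/-- **`Θ`-symmetry of the two-point weights**: reflecting the second plaquette of a pair in `x₀ = c` gives the same
centred weight as reflecting the first (odd-torus limit states are `Θ`-invariant and translation invariant). -/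
theorem M2_reflect_swap [T2Space G] [SecondCountableTopology G] (r : LatticeRep G) {β : ℝ} {μ : Measure (LGConfig 4 G)}
    (hμ : μ ∈ oddTorusLimitPoints r β) (p p' : (Fin 4 × Fin 4) × (Fin 4 → ℤ)) (hv : p.1.1 < p.1.2)
    (hv' : p'.1.1 < p'.1.2) (c : ℤ) :
    stateMomentStr G r μ 2 ![p.1, p'.1] ![p.2, reflSite 0 c p'] =
      stateMomentStr G r μ 2 ![p.1, p'.1] ![reflSite 0 c p, p'.2] := by
  have hΘ := map_configSiteReflect_zero_eq_of_mem_infiniteVolumeLimitPoints r.ρ r.continuous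
    (mem_infiniteVolumeLimitPoints_of_mem_oddTorusLimitPoints r hμ)
  have hq2 : ∀ i : Fin 2, ((![p.1, p'.1] : Fin 2 → Fin 4 × Fin 4) i).1 < ((![p.1, p'.1] : Fin 2 → _) i).2 := by
    intro i
    fin_cases i
    · exact hv
    · exact hv'
  rw [stateMomentStr_reflSite r hΘ hq2 ![p.2, reflSite 0 c p']]
  have h2 : (fun i => Summit.QuantumFields.YangMills.Theorems.InfVolRP.reflSite ((![p.1, p'.1] : Fin 2 → _) i)
      ((![p.2, reflSite 0 c p'] : Fin 2 → Site 4) i)) = ![reflSite 0 c p - tshift c, p'.2 - tshift c] := by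
    funext i
    fin_cases i
    · show Summit.QuantumFields.YangMills.Theorems.InfVolRP.reflSite p.1 p.2 = reflSite 0 c p - tshift c
      rw [← reflSite_zero_zero_eq (p := p) hv, reflSite_zero_eq_add c p, add_sub_cancel_right]
    · show Summit.QuantumFields.YangMills.Theorems.InfVolRP.reflSite p'.1 (reflSite 0 c p') = p'.2 - tshift c
      rw [← reflSite_zero_zero_eq (p := (p'.1, reflSite 0 c p')) hv', reflSite_zero_zero_hat c p']
  rw [h2, ← M2_translate r hμ p.1 p'.1 (reflSite 0 c p - tshift c) (p'.2 - tshift c) (tshift c), sub_add_cancel,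
    sub_add_cancel]

omit [Group G] [TopologicalSpace G] [IsTopologicalGroup G] [CompactSpace G] [MeasurableSpace G] [BorelSpace G] in
/-- **The mirror image of an admissible atom is an admissible atom**: by the profile's time symmetry
`b(T - u₀, u⃗) = b(u)`, the weight of the plaquette mirrored in `x₀ = c` is the weight of the original plaquette in
the atom with offset `ŷ = y + (2sc - 2y₀ - T)e₀`. -/
theorem atomWt_hat {b : SchwartzMap (EuclideanSpace ℝ (Fin 4)) ℝ} {T : ℝ}
    (hT : ∀ u : EuclideanSpace ℝ (Fin 4), b (WithLp.toLp 2 fun i => if i = 0 then T - u i else u i) = b u)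
    (Q : Finset (Fin 4 × Fin 4)) (s : ℝ) (y : EuclideanSpace ℝ (Fin 4)) (c : ℤ) (yh : EuclideanSpace ℝ (Fin 4))
    (hyh : yh = y + (2 * s * c - 2 * y 0 - T) • EuclideanSpace.single 0 (1 : ℝ))
    (p : (Fin 4 × Fin 4) × (Fin 4 → ℤ)) :
    atomWt b Q s yh p = atomWt b Q s y (p.1, reflSite 0 c p) := by
  unfold atomWt
  dsimp only
  by_cases h : p.1 ∈ Q ∧ p.1.1 < p.1.2
  · have h2 : p.1.2 ≠ 0 := fun h0 => by rw [h0] at h; exact (Fin.not_lt_zero _) h.2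
    rw [if_pos h, if_pos h, ← hT (s • (siteToE p.2 + centreOffset p.1) - yh)]
    congr 1
    ext i
    rw [PiLp.toLp_apply, atomArg_apply, atomArg_apply, hyh]
    simp only [PiLp.add_apply, PiLp.smul_apply, PiLp.single_apply, smul_eq_mul, mul_ite, mul_one, mul_zero]
    by_cases hi : i = 0
    · subst hi
      rw [if_pos rfl, if_pos rfl, centreOffset_apply_zero' p.1, if_pos h.2]
      simp only [reflSite, if_true, h2, or_false]
      split_ifs <;> push_cast <;> ring
    · rw [if_neg hi, if_neg hi]
      simp only [reflSite, hi, if_false]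
      ring
  · rw [if_neg h, if_neg h]
where
  /-- `InfVolRP.centreOffset_apply_zero`, restated to keep the `open` list short. -/
  centreOffset_apply_zero' (q : Fin 4 × Fin 4) :
      centreOffset q 0 = if q.1 < q.2 then (if q.1 = 0 then 1 / 2 else 0) else 0 :=
    Summit.QuantumFields.YangMills.Theorems.InfVolRP.centreOffset_apply_zero q

end Summit.QuantumFields.YangMills.Cruxes.AtomicCalibrationR.MirrorCalibration

end
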